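import Summits.AtomisticToContinuum.Crystallization.Theorems.ChartedPlanarOrderProfileSlavingLJBalance

/-!
# OverbindingBudget · decomp-a2c lens-4 g34 — part XXII-X: summing a span-indexed majorant over the straddling pairs of a gap

Helper file under `--supports stmt-AtomisticToContinuum-31280` (RDEF = `Theses.OverbindingBudget.RobustDefectLimitWindows`); closes nothing.

The layer pairs `(k, l)`, `k < m ≤ l`, straddling gap `m` are counted by their SPAN `s = l − k ≥ 1`: exactly `s` of them have span `s`
(`k = m − s, …, m − 1`).  Hence a family on the straddle set dominated termwise by `g(span)` with `g ≥ 0` and `Σ_s s·g(s) < ∞` is summable with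
sum `≤ Σ_s s·g(s)` (★ `summable_straddle_of_le`, `norm_tsum_straddle_le`).  This is the bookkeeping step of the g35 GEO-OSC node (memo §I):
the far stress across a gap (part V `farStress`) is bounded by `Σ_{s ≥ 2} s·(r_s + s·c_s·sup|h − h⋆|)` from per-span certificate rows
`(r_s, c_s)` and the analytic tail `r_s = 19/(s·h_lo)⁵` (part W `norm_layerForce_far`).
-/

namespace Summit.AtomisticToContinuum.Crystallization.Theorems.OverbindingBudgetEnergyStraddleCount

open Finset
open Summit.AtomisticToContinuum.Crystallization.Theorems.ChartedPlanarOrderChunkFloor (E3)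
open Summit.AtomisticToContinuum.Crystallization.Theorems.ChartedPlanarOrderProfileSlavingLJBalance (straddleSet)

/-- the span `l − k` of a layer pair `(k, l)` (as a natural number; `0` if `l < k`). -/
def span (p : ℤ × ℤ) : ℕ := (p.2 - p.1).toNat

/-- the straddling pairs of gap `m` with span `≤ S`, parametrised by `(s, i) ↦ (m − s + i, m + i)`, `i < s ≤ S`. -/
def pairOf (m : ℤ) (x : (_ : ℕ) × ℕ) : ℤ × ℤ := ((m : ℤ) - x.1 + x.2, (m : ℤ) + x.2)

/-- the parametrised pair `(m − s + i, m + i)` has span `s`. -/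
theorem span_pairOf (m : ℤ) (x : (_ : ℕ) × ℕ) : span (pairOf m x) = x.1 := by
  simp only [span, pairOf]
  rw [show (m : ℤ) + x.2 - (m - x.1 + x.2) = (x.1 : ℤ) by ring, Int.toNat_natCast]

/-- the parametrisation is injective on `{(s, i) : i < s ≤ S}`. -/
theorem pairOf_injOn (m : ℤ) (S : ℕ) :
    Set.InjOn (pairOf m) ↑((range (S + 1)).sigma fun s => range s) := by
  intro x _ y _ h
  simp only [pairOf, Prod.mk.injEq] at h
  obtain ⟨h1, h2⟩ := h
  have hy2 : x.2 = y.2 := by exact_mod_cast (add_left_cancel h2)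
  have hy1 : x.1 = y.1 := by
    have : (x.1 : ℤ) = y.1 := by rw [hy2] at h1; linarith
    exact_mod_cast this
  exact Sigma.ext hy1 (heq_of_eq hy2)

/-- **finite partial sums**: over any finite set of straddling pairs, `Σ g(span) ≤ Σ_s s·g(s)`. -/
theorem sum_straddle_le (m : ℤ) {g : ℕ → ℝ} (hg0 : ∀ s, 0 ≤ g s) (hgs : Summable fun s : ℕ => (s : ℝ) * g s)
    (u : Finset (straddleSet m)) : ∑ p ∈ u, g (span (p : ℤ × ℤ)) ≤ ∑' s : ℕ, (s : ℝ) * g s := by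
  classical
  set S : ℕ := u.sup fun p => span (p : ℤ × ℤ) with hS
  set T : Finset (ℤ × ℤ) := ((range (S + 1)).sigma fun s => range s).image (pairOf m) with hT
  -- (1) pass to `ℤ × ℤ`
  have e1 : ∑ p ∈ u, g (span (p : ℤ × ℤ)) = ∑ q ∈ u.map ⟨Subtype.val, Subtype.val_injective⟩, g (span q) := by
    rw [sum_map]; rfl
  -- (2) the image of `u` lies in the parametrised set `T`
  have hsub : u.map ⟨Subtype.val, Subtype.val_injective⟩ ⊆ T := by
    intro q hq
    rw [mem_map] at hq
    obtain ⟨p, hp, rfl⟩ := hq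
    have hk : (p : ℤ × ℤ).1 < m ∧ m ≤ (p : ℤ × ℤ).2 := p.2
    have hspan : span (p : ℤ × ℤ) ≤ S := le_sup (f := fun p : straddleSet m => span (p : ℤ × ℤ)) hp
    rw [hT, mem_image]
    refine ⟨⟨span (p : ℤ × ℤ), ((p : ℤ × ℤ).2 - m).toNat⟩, ?_, ?_⟩
    · rw [mem_sigma, mem_range, mem_range]
      dsimp only
      refine ⟨by omega, ?_⟩
      have h1 : ((((p : ℤ × ℤ).2 - m).toNat : ℕ) : ℤ) = (p : ℤ × ℤ).2 - m := Int.toNat_of_nonneg (by omega)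
      have h2 : ((span (p : ℤ × ℤ) : ℕ) : ℤ) = (p : ℤ × ℤ).2 - (p : ℤ × ℤ).1 := by
        simp only [span]; exact Int.toNat_of_nonneg (by omega)
      omega
    · have h1 : ((((p : ℤ × ℤ).2 - m).toNat : ℕ) : ℤ) = (p : ℤ × ℤ).2 - m := Int.toNat_of_nonneg (by omega)
      have h2 : ((span (p : ℤ × ℤ) : ℕ) : ℤ) = (p : ℤ × ℤ).2 - (p : ℤ × ℤ).1 := by
        simp only [span]; exact Int.toNat_of_nonneg (by omega)
      simp only [pairOf]
      show ((m : ℤ) - (span (p : ℤ × ℤ) : ℤ) + ((((p : ℤ × ℤ).2 - m).toNat : ℕ) : ℤ), (m : ℤ) + ((((p : ℤ × ℤ).2 - m).toNat : ℕ) : ℤ)) = (p : ℤ × ℤ)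
      rw [h1, h2]
      ext <;> simp only <;> ring
  -- (3) the sum over `T` is `Σ_{s ≤ S} s·g(s)`
  have e3 : ∑ q ∈ T, g (span q) = ∑ s ∈ range (S + 1), (s : ℝ) * g s := by
    rw [hT, sum_image (pairOf_injOn m S), sum_sigma]
    refine sum_congr rfl fun s _ => ?_
    simp only [span_pairOf, sum_const, card_range, nsmul_eq_mul]
  -- (4) conclude
  calc ∑ p ∈ u, g (span (p : ℤ × ℤ)) = ∑ q ∈ u.map ⟨Subtype.val, Subtype.val_injective⟩, g (span q) := e1
    _ ≤ ∑ q ∈ T, g (span q) := sum_le_sum_of_subset_of_nonneg hsub fun _ _ _ => hg0 _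
    _ = ∑ s ∈ range (S + 1), (s : ℝ) * g s := e3
    _ ≤ ∑' s : ℕ, (s : ℝ) * g s := hgs.sum_le_tsum (range (S + 1)) fun s _ => mul_nonneg (Nat.cast_nonneg _) (hg0 s)

/-- ★ **span-majorant summation**: a nonnegative family on the straddle set of gap `m` dominated by `g(span)`, `g ≥ 0`, `Σ_s s·g(s) < ∞`,
is summable with sum `≤ Σ_s s·g(s)`. -/
theorem summable_straddle_of_le (m : ℤ) {f : straddleSet m → ℝ} {g : ℕ → ℝ} (hf0 : ∀ p, 0 ≤ f p)
    (hfg : ∀ p, f p ≤ g (span (p : ℤ × ℤ))) (hg0 : ∀ s, 0 ≤ g s) (hgs : Summable fun s : ℕ => (s : ℝ) * g s) :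
    Summable f ∧ ∑' p, f p ≤ ∑' s : ℕ, (s : ℝ) * g s := by
  have hbd : ∀ u : Finset (straddleSet m), ∑ p ∈ u, f p ≤ ∑' s : ℕ, (s : ℝ) * g s := fun u =>
    (sum_le_sum fun p _ => hfg p).trans (sum_straddle_le m hg0 hgs u)
  exact ⟨summable_of_sum_le hf0 hbd, Real.tsum_le_of_sum_le hf0 hbd⟩

/-- ★ vector version: a family of vectors on the straddle set with `‖F p‖ ≤ g(span p)` is summable and `‖Σ' F‖ ≤ Σ_s s·g(s)`. -/
theorem norm_tsum_straddle_le (m : ℤ) {F : straddleSet m → E3} {g : ℕ → ℝ} (hFg : ∀ p, ‖F p‖ ≤ g (span (p : ℤ × ℤ)))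
    (hg0 : ∀ s, 0 ≤ g s) (hgs : Summable fun s : ℕ => (s : ℝ) * g s) :
    Summable F ∧ ‖∑' p, F p‖ ≤ ∑' s : ℕ, (s : ℝ) * g s := by
  obtain ⟨hN, hle⟩ := summable_straddle_of_le m (f := fun p => ‖F p‖) (fun p => norm_nonneg _) hFg hg0 hgs
  have hF : Summable F := hN.of_norm
  exact ⟨hF, (norm_tsum_le_tsum_norm hN).trans hle⟩

/-- the straddling pairs of span `s` have offsets over exactly `s` consecutive gaps: if every gap height lies in `[h_lo, h_hi]` then a
straddling pair's total height lies in `[s·h_lo, s·h_hi]` (bookkeeping for the certificate windows). -/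
theorem sum_Ioc_mem_Icc {h : ℤ → ℝ} {hlo hhi : ℝ} (hh : ∀ i, hlo ≤ h i ∧ h i ≤ hhi) (k l : ℤ) :
    (span (k, l) : ℝ) * hlo ≤ ∑ i ∈ Finset.Ioc k l, h i ∧ ∑ i ∈ Finset.Ioc k l, h i ≤ (span (k, l) : ℝ) * hhi := by
  have hcard : ((Finset.Ioc k l).card : ℝ) = (span (k, l) : ℝ) := by
    rw [Int.card_Ioc]; simp [span]
  constructor
  · calc (span (k, l) : ℝ) * hlo = ∑ _i ∈ Finset.Ioc k l, hlo := by rw [sum_const, nsmul_eq_mul, hcard]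
      _ ≤ ∑ i ∈ Finset.Ioc k l, h i := sum_le_sum fun i _ => (hh i).1
  · calc ∑ i ∈ Finset.Ioc k l, h i ≤ ∑ _i ∈ Finset.Ioc k l, hhi := sum_le_sum fun i _ => (hh i).2
      _ = (span (k, l) : ℝ) * hhi := by rw [sum_const, nsmul_eq_mul, hcard]

end Summit.AtomisticToContinuum.Crystallization.Theorems.OverbindingBudgetEnergyStraddleCount
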